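import Summits.AtomisticToContinuum.Crystallization.Theses.ReggeStarCoercivity
import Literature.MathematicalPhysics.StatisticalMechanics.PeriodicConfigurationSums
import Literature.MathematicalPhysics.StatisticalMechanics.LennardJonesClusters
import Literature.Barriers.AtomisticToContinuum.SutoDegenerateGroundStates

/-!
# `PeriodicStarCoercivity → StarCoercivity` (13602 ⇒ 13600) by periodisation

Route `ReggeStarCoercivity` (sub-problem `Crystallization` of `AtomisticToContinuum`). The route files the torus
twin `PeriodicStarCoercivity` (item stmt-AtomisticToContinuum-13602) with `deps: StarCoercivity`; this file lands the
CONVERSE edge as a tree theorem — `starCoercivity_of_periodicStarCoercivity : PeriodicStarCoercivity → StarCoercivity`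
(in the `C = 0` form) — so that a proof of 13602 closes the crux 13600 by modus ponens. The argument and the Lean
text are those of the standing adversary file `Cruxes/StarCoercivity/Disproof.lean` §0/§5/§9 (cdisprove g2–g3,
kernel-checked there; `Cruxes/` is not importable from `Theorems/`, hence this port, adapted: the `C = 0` form is fed
to the crux directly, without the §8 copies lemma).

PROOF. Periodise an injective `x : Fin N → ℝ³` (`N ≥ 1`) with the cubic lattice `Lℤ³`, `L = 2Σᵢ‖xᵢ‖ + 2`
(`periodise`; motif `= {xᵢ}`, pairwise inequivalent since distinct motif points differ by `< L`). Non-trivial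
periods have length `≥ L`, so the other copies are at distance `≥ 2` from every `xᵢ`: (i) the `6/5`-shells read in
`P.points` are the shells of `x` (`toFinset_inter_points_image`), so the defective motif fraction is `#Def(x)/N`
(`card_filter_motif_periodise`); (ii) `V_LJ ≤ 0` beyond distance `1`, so each lattice site sum is at most the finite
site energy (`tsum_le_siteEnergy`, `sum_le_hasSum` on the summable `r⁻⁶` tail `summable_lennardJones_dist_three`),
whence `e(P) ≤ E_LJ(x)/N` (`energyPerParticle_periodise_le`). Feeding `P` to `PeriodicStarCoercivity` gives
`e_per + g·#Def(x)/N ≤ E_LJ(x)/N`, i.e. the crux inequality with the same `g` and `C = 0`.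
-/

noncomputable section

namespace Summit.AtomisticToContinuum.Crystallization.Theorems.StarCoercivityPeriodisation

open scoped BigOperators Classical
open Literature.MathematicalPhysics.StatisticalMechanics Literature.Geometry.DiscreteGeometry
open Summit.AtomisticToContinuum.Crystallization.Theses.ReggeStarCoercivity (StarCoercivity PeriodicStarCoercivity)

/-! ## The crux's sub-expressions -/

/-- `e_per = ⨅_Q e(Q)`, the infimum over periodic configurations of `ℝ³` of the Lennard-Jones
energy per particle (a conditionally complete infimum: junk value `0` if the range were not
bounded below). [folklore] -/
def ePer : ℝ := ⨅ Q : PeriodicConfiguration 3, Q.energyPerParticle lennardJones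

/-- The recentred, `a⁻¹`-rescaled first shell (absolute radius `6/5`) of site `i`, verbatim from
the crux. [folklore] -/
def shell {N : ℕ} (x : Fin N → (EuclideanSpace ℝ (Fin 3))) (i : Fin N) (a : ℝ) : Finset (EuclideanSpace ℝ (Fin 3)) :=
  (Finset.univ.filter fun j : Fin N => j ≠ i ∧ dist (x i) (x j) ≤ 6 / 5).image
    fun j => a⁻¹ • (x j - x i)

/-- Site `i` is DEFECTIVE (verbatim from the crux, through `shell`): no dilation
`a ∈ [9/10, 11/10]` makes its shell `1/20`-close (bijectively, after a linear isometry) to the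
fcc or the hcp kissing pattern. [folklore] -/
def IsDefective {N : ℕ} (x : Fin N → (EuclideanSpace ℝ (Fin 3))) (i : Fin N) : Prop :=
  ¬ ∃ a : ℝ, 9 / 10 ≤ a ∧ a ≤ 11 / 10 ∧
    (ShellCloseTo (1 / 20) (shell x i a) fccKissingPattern ∨
     ShellCloseTo (1 / 20) (shell x i a) hcpKissingPattern)

/-- The number of defective sites `#Def(x)`. [folklore] -/
def defects {N : ℕ} (x : Fin N → (EuclideanSpace ℝ (Fin 3))) : ℕ := Nat.card {i : Fin N // IsDefective x i}


/-! ## Bookkeeping -/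

/-- `#Def(x) ≤ N`. [folklore] -/
theorem defects_le {N : ℕ} (x : Fin N → (EuclideanSpace ℝ (Fin 3))) : defects x ≤ N := by
  unfold defects
  calc Nat.card {i : Fin N // IsDefective x i} ≤ Nat.card (Fin N) := Finite.card_subtype_le _
    _ = N := by simp


/-! ## Periodisation with a large cubic period (Disproof §5) -/

section Periodise

open Literature.Barriers.AtomisticToContinuum (cubicLattice cubicBasis cubicBasis_apply)

variable {N : ℕ} (x : Fin N → (EuclideanSpace ℝ (Fin 3)))

/-- A bound on all the norms `‖x i‖`. -/
def normBound : ℝ := ∑ i, ‖x i‖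

/-- [folklore] (ported from `Cruxes/StarCoercivity/Disproof.lean` §5) -/
theorem norm_le_normBound (i : Fin N) : ‖x i‖ ≤ normBound x :=
  Finset.single_le_sum (f := fun i => ‖x i‖) (fun _ _ => norm_nonneg _) (Finset.mem_univ i)

/-- [folklore] (ported from `Cruxes/StarCoercivity/Disproof.lean` §5) -/
theorem normBound_nonneg : 0 ≤ normBound x := Finset.sum_nonneg fun _ _ => norm_nonneg _

/-- [folklore] (ported from `Cruxes/StarCoercivity/Disproof.lean` §5) -/
theorem norm_sub_le_two_normBound (i j : Fin N) : ‖x i - x j‖ ≤ 2 * normBound x :=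
  (norm_sub_le _ _).trans (by linarith [norm_le_normBound x i, norm_le_normBound x j])

/-- The period `L = 2·Σ‖x i‖ + 2`. -/
def period : ℝ := 2 * normBound x + 2

/-- [folklore] (ported from `Cruxes/StarCoercivity/Disproof.lean` §5) -/
theorem period_pos : 0 < period x := by unfold period; linarith [normBound_nonneg x]

/-- The period as a unit of `ℝ`. -/
def periodUnit : ℝˣ := Units.mk0 (period x) (period_pos x).ne'

/-- [folklore] (ported from `Cruxes/StarCoercivity/Disproof.lean` §5) -/
@[simp] theorem val_periodUnit : (periodUnit x : ℝ) = period x := rfl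

/-- Coordinates of vectors of the cubic lattice `cℤ³` are integer multiples of `c`. [folklore] -/
theorem exists_int_coord_of_mem_cubicLattice (c : ℝˣ) {v : (EuclideanSpace ℝ (Fin 3))} (hv : v ∈ cubicLattice c)
    (j : Fin 3) : ∃ n : ℤ, v j = (c : ℝ) * n := by
  induction hv using Submodule.span_induction generalizing j with
  | mem v hv =>
    obtain ⟨i, rfl⟩ := hv
    rw [cubicBasis_apply]
    by_cases hji : j = i
    · subst hji; exact ⟨1, by simp⟩
    · exact ⟨0, by simp [hji]⟩
  | zero => exact ⟨0, by simp⟩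
  | add u w _ _ hu hw =>
    obtain ⟨n, hn⟩ := hu j
    obtain ⟨m, hm⟩ := hw j
    exact ⟨n + m, by simp [hn, hm, mul_add]⟩
  | smul a u _ hu =>
    obtain ⟨n, hn⟩ := hu j
    exact ⟨a * n, by simp [hn]; ring⟩

/-- Non-zero vectors of `cℤ³` (`c > 0`) have norm `≥ c`. [folklore] -/
theorem le_norm_of_mem_cubicLattice {c : ℝˣ} (hc : 0 < (c : ℝ)) {v : (EuclideanSpace ℝ (Fin 3))}
    (hv : v ∈ cubicLattice c) (hv0 : v ≠ 0) : (c : ℝ) ≤ ‖v‖ := by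
  have hex : ∃ j, v j ≠ 0 := by
    by_contra hall
    push Not at hall
    exact hv0 (PiLp.ext fun j => by simpa using hall j)
  obtain ⟨j, hj⟩ := hex
  obtain ⟨n, hn⟩ := exists_int_coord_of_mem_cubicLattice c hv j
  have hn0 : n ≠ 0 := by
    rintro rfl
    simp at hn
    exact hj hn
  have hn1 : (1 : ℝ) ≤ |(n : ℝ)| := by
    rw [← Int.cast_abs]; exact_mod_cast Int.one_le_abs hn0
  have hcoord : |v j| ≤ ‖v‖ := by
    have := PiLp.norm_apply_le v j
    simpa using this
  calc (c : ℝ) ≤ (c : ℝ) * |(n : ℝ)| := le_mul_of_one_le_right hc.le hn1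
    _ = |v j| := by rw [hn, abs_mul, abs_of_pos hc]
    _ ≤ ‖v‖ := hcoord

/-- **Periodisation** of a configuration of `N ≥ 1` points of `ℝ³` with the cubic lattice of
period `L = 2Σ‖xᵢ‖ + 2` (motif `= {xᵢ}`; distinct motif points differ by less than `L`, the
length of the shortest non-zero period). [folklore] -/
def periodise (hN : 0 < N) : PeriodicConfiguration 3 where
  lattice := cubicLattice (periodUnit x)
  discrete := inferInstance
  isZLattice := inferInstance
  motif := Finset.univ.image x
  motif_nonempty := by
    haveI : Nonempty (Fin N) := ⟨⟨0, hN⟩⟩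
    exact Finset.univ_nonempty.image x
  eq_of_sub_mem := by
    intro p hp q hq hpq
    obtain ⟨i, -, rfl⟩ := Finset.mem_image.1 hp
    obtain ⟨j, -, rfl⟩ := Finset.mem_image.1 hq
    by_contra hne
    have h1 := le_norm_of_mem_cubicLattice (c := periodUnit x) (period_pos x) hpq
      (sub_ne_zero.2 hne)
    have h2 := norm_sub_le_two_normBound x i j
    rw [val_periodUnit, period] at h1
    linarith

/-- [folklore] (ported from `Cruxes/StarCoercivity/Disproof.lean` §5) -/
theorem motif_periodise (hN : 0 < N) : (periodise x hN).motif = Finset.univ.image x := rfl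

/-- Points of the periodisation other than the `xⱼ` themselves are at distance `≥ 1` from every
`xᵢ` (a non-zero period has length `≥ L = 2Σ‖xᵢ‖ + 2`). [folklore] -/
theorem one_le_dist_of_mem_points (hN : 0 < N) (i : Fin N) {y : (EuclideanSpace ℝ (Fin 3))}
    (hy : y ∈ (periodise x hN).points) (hyx : ∀ j, y ≠ x j) : 1 ≤ dist (x i) y := by
  obtain ⟨z, hz, g, hg, rfl⟩ := hy
  rw [motif_periodise] at hz
  obtain ⟨j, -, rfl⟩ := Finset.mem_image.1 hz
  have hg0 : g ≠ 0 := by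
    rintro rfl
    exact hyx j (by simp)
  have hL : period x ≤ ‖g‖ := by
    have := le_norm_of_mem_cubicLattice (c := periodUnit x) (period_pos x) hg hg0
    simpa using this
  rw [dist_eq_norm]
  have h1 : ‖g‖ - ‖x i - x j‖ ≤ ‖x i - (x j + g)‖ := by
    rw [show x i - (x j + g) = (x i - x j) - g by abel, ← norm_neg ((x i - x j) - g), neg_sub]
    exact norm_sub_norm_le g (x i - x j)
  have h2 := norm_sub_le_two_normBound x i j
  unfold period at hL
  linarith

variable {x}

/-- In fact they are at distance `≥ 2 > 6/5`, so they never enter a `6/5`-shell. [folklore] -/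
theorem two_le_dist_of_mem_points (hN : 0 < N) (i : Fin N) {y : (EuclideanSpace ℝ (Fin 3))}
    (hy : y ∈ (periodise x hN).points) (hyx : ∀ j, y ≠ x j) : 2 ≤ dist (x i) y := by
  obtain ⟨z, hz, g, hg, rfl⟩ := hy
  rw [motif_periodise] at hz
  obtain ⟨j, -, rfl⟩ := Finset.mem_image.1 hz
  have hg0 : g ≠ 0 := by
    rintro rfl
    exact hyx j (by simp)
  have hL : period x ≤ ‖g‖ := by
    have := le_norm_of_mem_cubicLattice (c := periodUnit x) (period_pos x) hg hg0
    simpa using this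
  rw [dist_eq_norm]
  have h1 : ‖g‖ - ‖x i - x j‖ ≤ ‖x i - (x j + g)‖ := by
    rw [show x i - (x j + g) = (x i - x j) - g by abel, ← norm_neg ((x i - x j) - g), neg_sub]
    exact norm_sub_norm_le g (x i - x j)
  have h2 := norm_sub_le_two_normBound x i j
  unfold period at hL
  linarith

/-- The points of the periodisation in the punctured `6/5`-ball about `xᵢ`, recentred and
rescaled, are exactly `shell x i a`: the shells "read in `P.points`" (as in
`PeriodicStarCoercivity`, item 13602) are the shells of `x`. [folklore] -/
theorem toFinset_inter_points_image (hN : 0 < N) (hx : Function.Injective x) (i : Fin N) (a : ℝ)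
    (hfin : ((Metric.closedBall (x i) (6 / 5) \ {x i}) ∩ (periodise x hN).points).Finite) :
    hfin.toFinset.image (fun y => a⁻¹ • (y - x i)) = shell x i a := by
  ext v
  simp only [Finset.mem_image, Set.Finite.mem_toFinset, Set.mem_inter_iff,
    Metric.mem_closedBall, Set.mem_singleton_iff, shell, Finset.mem_filter, Finset.mem_univ,
    true_and, Set.mem_sdiff]
  constructor
  · rintro ⟨y, ⟨⟨hyb, hys⟩, hyP⟩, rfl⟩
    have hex : ∃ j, y = x j := by
      by_contra hno
      push Not at hno
      have := two_le_dist_of_mem_points hN i hyP hno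
      rw [dist_comm] at hyb
      linarith
    obtain ⟨j, rfl⟩ := hex
    exact ⟨j, ⟨fun hji => hys (by rw [hji]), by rwa [dist_comm] at hyb⟩, rfl⟩
  · rintro ⟨j, ⟨hji, hd⟩, rfl⟩
    refine ⟨x j, ⟨⟨by rwa [dist_comm], fun h => hji (hx h)⟩, ?_⟩, rfl⟩
    exact (periodise x hN).mem_points_of_mem_motif (by
      rw [motif_periodise]; exact Finset.mem_image_of_mem x (Finset.mem_univ j))

/-- Hence the number of motif points of the periodisation failing ANY predicate that agrees with
`IsDefective x` on the `xᵢ` is `#Def(x)`. [folklore] -/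
theorem card_filter_motif_periodise (hN : 0 < N) (hx : Function.Injective x) (p : (EuclideanSpace ℝ (Fin 3)) → Prop)
    {hdec : DecidablePred p} (hp : ∀ i, p (x i) ↔ IsDefective x i) :
    (@Finset.filter _ p hdec (periodise x hN).motif).card = defects x := by
  rw [motif_periodise, Finset.filter_image, Finset.card_image_of_injective _ hx]
  unfold defects
  rw [Nat.card_eq_fintype_card, Fintype.card_subtype]
  congr 1
  exact Finset.filter_congr fun i _ => hp i

/-- The lattice sum at `xᵢ` over the periodisation is at most the finite site energy
`∑_{k ≠ i} V_LJ(|xᵢ − x_k|)`: the remaining terms are `≤ 0`. [folklore] -/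
theorem tsum_le_siteEnergy (hx : Function.Injective x) (hN : 0 < N) (i : Fin N) :
    (∑' y : {y : (EuclideanSpace ℝ (Fin 3)) // y ∈ (periodise x hN).points ∧ y ≠ x i},
        lennardJones (dist (x i) y.1)) ≤ siteEnergy lennardJones x i := by
  set P := periodise x hN with hP
  set f : {y : (EuclideanSpace ℝ (Fin 3)) // y ∈ P.points ∧ y ≠ x i} → ℝ := fun y => lennardJones (dist (x i) y.1)
    with hf
  have hsum : Summable f := P.summable_lennardJones_dist_three (x i)
  have hmem : ∀ k : {k // k ∈ Finset.univ.erase i}, x k.1 ∈ P.points ∧ x k.1 ≠ x i := fun k =>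
    ⟨P.mem_points_of_mem_motif (by
        rw [hP, motif_periodise]; exact Finset.mem_image_of_mem x (Finset.mem_univ _)),
      hx.ne (Finset.ne_of_mem_erase k.2)⟩
  set emb : {k // k ∈ Finset.univ.erase i} → {y : (EuclideanSpace ℝ (Fin 3)) // y ∈ P.points ∧ y ≠ x i} :=
    fun k => ⟨x k.1, hmem k⟩ with hemb
  have hinj : Function.Injective emb := by
    intro k l hkl
    have h1 : x k.1 = x l.1 := congrArg Subtype.val hkl
    exact Subtype.ext (hx h1)
  set s₀ : Finset {y : (EuclideanSpace ℝ (Fin 3)) // y ∈ P.points ∧ y ≠ x i} := (Finset.univ.erase i).attach.image emb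
    with hs₀
  have hsign : ∀ y ∉ s₀, 0 ≤ (fun b => -f b) y := by
    intro y hy
    have hfar : ∀ j, y.1 ≠ x j := by
      intro j hj
      by_cases hji : j = i
      · exact y.2.2 (hji ▸ hj)
      · exact hy (Finset.mem_image.2 ⟨⟨j, Finset.mem_erase.2 ⟨hji, Finset.mem_univ j⟩⟩,
          Finset.mem_attach _ _, Subtype.ext hj.symm⟩)
    have h1 := one_le_dist_of_mem_points x hN i y.2.1 hfar
    simp only [hf, neg_nonneg]
    exact lennardJones_nonpos h1
  have h1 := sum_le_hasSum s₀ hsign hsum.hasSum.neg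
  have h2 : ∑ y ∈ s₀, f y = siteEnergy lennardJones x i := by
    rw [hs₀, Finset.sum_image fun k _ l _ h => hinj h]
    exact Finset.sum_attach (Finset.univ.erase i) fun k => lennardJones (dist (x i) (x k))
  rw [Finset.sum_neg_distrib, h2] at h1
  linarith

/-- Hence `e(periodisation of x) ≤ E_LJ(x)/N`. [folklore] -/
theorem energyPerParticle_periodise_le (hx : Function.Injective x) (hN : 0 < N) :
    (periodise x hN).energyPerParticle lennardJones ≤ interactionEnergy lennardJones x / N := by
  have hcard : (periodise x hN).motif.card = N := by
    rw [motif_periodise, Finset.card_image_of_injective _ hx, Finset.card_univ, Fintype.card_fin]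
  have hNr : (0 : ℝ) < N := by exact_mod_cast hN
  unfold PeriodicConfiguration.energyPerParticle
  rw [hcard]
  have hsum : ∑ z ∈ (periodise x hN).motif,
      ∑' y : {y : (EuclideanSpace ℝ (Fin 3)) // y ∈ (periodise x hN).points ∧ y ≠ z}, lennardJones (dist z y.1) ≤
        ∑ i, siteEnergy lennardJones x i := by
    rw [motif_periodise, Finset.sum_image fun i _ j _ h => hx h]
    exact Finset.sum_le_sum fun i _ => tsum_le_siteEnergy hx hN i
  rw [← two_mul_interactionEnergy] at hsum
  calc (2 * (N : ℝ))⁻¹ * ∑ z ∈ (periodise x hN).motif,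
        ∑' y : {y : (EuclideanSpace ℝ (Fin 3)) // y ∈ (periodise x hN).points ∧ y ≠ z}, lennardJones (dist z y.1)
      ≤ (2 * (N : ℝ))⁻¹ * (2 * interactionEnergy lennardJones x) :=
        mul_le_mul_of_nonneg_left hsum (by positivity)
    _ = interactionEnergy lennardJones x / N := by
        field_simp

end Periodise

/-! ## 13602 ⇒ 13600 -/

/-- **`PeriodicStarCoercivity → StarCoercivity`** (items 13602 ⇒ 13600; the implication lands in the `C = 0` form):
feed the periodisation of `x` to the torus statement — its defective motif fraction is `#Def(x)/N`
(`card_filter_motif_periodise`, `toFinset_inter_points_image`) and its energy per particle is `≤ E_LJ(x)/N`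
(`energyPerParticle_periodise_le`). CONDITIONAL on `PeriodicStarCoercivity` (open). [folklore] -/
theorem starCoercivity_of_periodicStarCoercivity (h : PeriodicStarCoercivity) : StarCoercivity := by
  obtain ⟨g, hg, hP⟩ := h
  refine ⟨g, hg, 0, fun N x hx => ?_⟩
  show (N : ℝ) * ePer + g * (defects x : ℝ) - 0 * (N : ℝ) ^ (2 / 3 : ℝ) ≤ interactionEnergy lennardJones x
  simp only [zero_mul, sub_zero]
  rcases Nat.eq_zero_or_pos N with rfl | hN
  · have hd : defects x = 0 := by have := defects_le x; omega
    simp [interactionEnergy, hd]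
  · have key := hP (periodise x hN)
    rw [card_filter_motif_periodise hN hx _ (fun i => ?_)] at key
    · have hcardm : (((periodise x hN).motif.card : ℕ) : ℝ) = N := by
        rw [motif_periodise, Finset.card_image_of_injective _ hx]
        simp
      rw [hcardm] at key
      have h2 := energyPerParticle_periodise_le hx hN
      have hNr : (0 : ℝ) < N := by exact_mod_cast hN
      have h3 : ePer + g * (defects x : ℝ) / N ≤ interactionEnergy lennardJones x / N :=
        key.trans h2
      calc (N : ℝ) * ePer + g * (defects x : ℝ) = (ePer + g * (defects x : ℝ) / N) * N := by
            field_simp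
        _ ≤ interactionEnergy lennardJones x / N * N := mul_le_mul_of_nonneg_right h3 hNr.le
        _ = interactionEnergy lennardJones x := by field_simp
    · simp only [toFinset_inter_points_image hN hx i, IsDefective]

/-- Registered-stub form of `starCoercivity_of_periodicStarCoercivity` (stub `stub_periodicTransfer` of crux
stmt-AtomisticToContinuum-13600: the torus entry of line `separation-padding-transfer`). -/
theorem stub_periodicTransfer : Summit.AtomisticToContinuum.Crystallization.Theses.ReggeStarCoercivity.PeriodicStarCoercivity → Summit.AtomisticToContinuum.Crystallization.Theses.ReggeStarCoercivity.StarCoercivity :=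
  starCoercivity_of_periodicStarCoercivity

end Summit.AtomisticToContinuum.Crystallization.Theorems.StarCoercivityPeriodisation

end
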